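import Literature.AlgebraicGeometry.Morphisms.EtaleLocusFibres
import Literature.AlgebraicGeometry.Motives.ClosedGraphMorphism
import HarnessLib

/-!
# Finite fibres of rational points ⇒ finite scheme-theoretic fibres (and alterations)

Topic `Literature/AlgebraicGeometry/Motives`, companion of `AlgPoints.lean` and of ★
`Morphisms/EtaleLocusFibres.lean` (§3: «proper + finite non-empty fibres over the closed points of a
non-empty open ⇒ alteration»).  Over an ALGEBRAICALLY CLOSED field `k`, for `k`-schemes locally of
finite type, the closed points are exactly the points of `k`-rational points (Hilbert's
Nullstellensatz, Mathlib `pointEquivClosedPoint`), so fibre data are usually available in the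
currency of `k`-points (★ `Motives/ClosedGraphMorphism`: `AlgPoints.eq_of_pt_eq`,
`AlgPoints.exists_pt_eq_of_isClosed_singleton`, `AlgPoints.isClosed_singleton_pt`): «the `k`-points of
`X` over the `k`-point `a` of `S` form a finite non-empty set».  This file converts that currency into the set-theoretic one consumed by
`isAlteration_of_finite_nonempty_preimage_of_isClosed`:

* `Set.Finite.of_isClosed_of_finite_inter_closedPoints` — in a JACOBSON space a closed set with
  finitely many closed points is finite (closed points are dense in closed sets);
* `AlgPoints.preimage_pt_inter_closedPoints` — the closed points of the fibre `ψ⁻¹(a)` are the points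
  of the `k`-points `z` of `X` with `ψ(z) = a`;
* `AlgPoints.finite_preimage_pt` ∕ `AlgPoints.nonempty_preimage_pt` — finitely many (resp. some)
  `k`-points over `a` ⇒ the fibre `ψ⁻¹(a) ⊆ X` is a finite (resp. non-empty) SET;
* `AlgPoints.isAlteration_left_of_finite_nonempty_fibres` — **a proper `k`-morphism from an integral
  `X` to an irreducible `S` whose `k`-point fibres over the `k`-points of a non-empty open `U ⊆ S`
  are finite and non-empty is an alteration** (`Resolution.IsAlteration ψ.left`).

The use (cell `hodgecm-mathlib`, road (E) of Lange Lemma 4.4.4 ∕ Milne JV Lemma 6.7): the incidence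
`ψ : C × W̃_{g-1} → J`, `(Q, b) ↦ α(Q)·b`, whose fibre over a general `a ∈ J(k)` is the known finite
set of points of the divisor `D(a)`; with ★ `EtaleLocusFibresCharZero` it is then finite étale over a
dense open, so its general fibres are reduced.

## References

* [Hartshorne1977] R. Hartshorne, *Algebraic Geometry*, II Ex. 2.7 (rational points), II Ex. 3.14
  and II.4 (closed points of schemes of finite type over a field).
* [GortzWedhorn2020] U. Görtz, T. Wedhorn, *Algebraic Geometry I*, 2nd ed., Prop. 3.35 (closed
  points of `k`-schemes locally of finite type are very dense), §(3.13) (Jacobson schemes).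
* [DeJong1996] A. J. de Jong, Publ. Math. IHÉS 83 (1996), 2.20 (alterations).
-/

noncomputable section

open CategoryTheory AlgebraicGeometry TopologicalSpace

universe u

/-! ## §1 Topology: closed sets with finitely many closed points in a Jacobson space -/

/-- **In a Jacobson space a closed set with finitely many closed points is finite**: the closed
points of `Z` are dense in `Z` (Jacobson), and a finite set of closed points is closed, so `Z` is
that finite set. [cite: GortzWedhorn2020, Section (3.13) and Prop. 3.35] -/
theorem Set.Finite.of_isClosed_of_finite_inter_closedPoints {X : Type*} [TopologicalSpace X]
    [JacobsonSpace X] {Z : Set X} (hZ : IsClosed Z) (hfin : (Z ∩ closedPoints X).Finite) :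
    Z.Finite := by
  have hcl : IsClosed (Z ∩ closedPoints X) := by
    rw [← Set.biUnion_of_singleton (Z ∩ closedPoints X)]
    exact hfin.isClosed_biUnion fun x hx => (mem_closedPoints_iff.mp hx.2)
  have hZeq : Z = Z ∩ closedPoints X := by
    conv_lhs => rw [← closure_inter_closedPoints hZ]
    exact hcl.closure_eq
  rw [hZeq]
  exact hfin

namespace Literature.AlgebraicGeometry.Motives

namespace AlgPoints

variable {k : Type u} [Field k] {X S : SchemeOver k}

/-! ## §2 Closed points of a fibre versus `k`-points over a `k`-point -/

/-- **Some `k`-point over `a` ⇒ the fibre `ψ⁻¹(a)` is a non-empty set.** [cite: Hartshorne1977, II Ex. 2.7] -/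
theorem nonempty_preimage_pt (ψ : X ⟶ S) (a : AlgPoints S k)
    (h : {z : AlgPoints X k | map ψ z = a}.Nonempty) : (ψ.left.base ⁻¹' {a.pt}).Nonempty := by
  obtain ⟨z, hz⟩ := h
  refine ⟨z.pt, ?_⟩
  change ψ.left.base z.pt = a.pt
  rw [← hz, pt_map]

variable [IsAlgClosed k]

/-- **The closed points of the fibre `ψ⁻¹(a)` are the points of the `k`-points over `a`** (`k`
algebraically closed, `X` and `S` locally of finite type over `k`, `a ∈ S(k)`).
[cite: Hartshorne1977, II Ex. 2.7 and Ex. 3.14] [cite: GortzWedhorn2020, Prop. 3.35] -/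
theorem preimage_pt_inter_closedPoints [LocallyOfFiniteType X.hom] [LocallyOfFiniteType S.hom]
    (ψ : X ⟶ S) (a : AlgPoints S k) :
    ψ.left.base ⁻¹' {a.pt} ∩ closedPoints X.left = AlgPoints.pt '' {z : AlgPoints X k | map ψ z = a} := by
  ext x
  simp only [Set.mem_inter_iff, Set.mem_preimage, Set.mem_singleton_iff, mem_closedPoints_iff,
    Set.mem_image, Set.mem_setOf_eq]
  constructor
  · rintro ⟨hx, hcl⟩
    obtain ⟨z, rfl⟩ := AlgPoints.exists_pt_eq_of_isClosed_singleton (X := X) hcl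
    refine ⟨z, AlgPoints.eq_of_pt_eq (X := S) ?_, rfl⟩
    rw [pt_map]
    exact hx
  · rintro ⟨z, hz, rfl⟩
    refine ⟨?_, z.isClosed_singleton_pt⟩
    rw [← hz, pt_map]

/-- **Finitely many `k`-points over `a` ⇒ the fibre `ψ⁻¹(a)` is a finite set** (`k` algebraically
closed, `X`, `S` locally of finite type over `k`): `X` is Jacobson and the closed points of the closed
set `ψ⁻¹(a)` are the points of the finitely many `k`-points over `a`.
[cite: GortzWedhorn2020, Prop. 3.35 and Section (3.13)] [cite: Hartshorne1977, II Ex. 3.14] -/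
theorem finite_preimage_pt [LocallyOfFiniteType X.hom] [LocallyOfFiniteType S.hom] (ψ : X ⟶ S)
    (a : AlgPoints S k) (h : {z : AlgPoints X k | map ψ z = a}.Finite) :
    (ψ.left.base ⁻¹' {a.pt}).Finite := by
  haveI : JacobsonSpace X.left := LocallyOfFiniteType.jacobsonSpace X.hom
  have hcl : IsClosed (ψ.left.base ⁻¹' {a.pt}) :=
    a.isClosed_singleton_pt.preimage ψ.left.continuous
  refine Set.Finite.of_isClosed_of_finite_inter_closedPoints hcl ?_
  rw [preimage_pt_inter_closedPoints ψ a]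
  exact h.image _

/-- The same two conversions in the form consumed by ★ `isAlteration_of_finite_nonempty_preimage_of_isClosed`:
over the closed points of an open `U ⊆ S`, fibre finiteness follows from finiteness of the `k`-point
fibres over the `k`-points of `U`. [cite: GortzWedhorn2020, Prop. 3.35] -/
theorem finite_preimage_of_isClosed_of_finite_fibres [LocallyOfFiniteType X.hom]
    [LocallyOfFiniteType S.hom] (ψ : X ⟶ S) (U : S.left.Opens)
    (hfin : ∀ a : AlgPoints S k, a.pt ∈ U → {z : AlgPoints X k | map ψ z = a}.Finite)
    (s : S.left) (hs : s ∈ U) (hcl : IsClosed ({s} : Set S.left)) :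
    (ψ.left.base ⁻¹' {s}).Finite := by
  obtain ⟨a, rfl⟩ := AlgPoints.exists_pt_eq_of_isClosed_singleton (X := S) hcl
  exact finite_preimage_pt ψ a (hfin a hs)

/-- Non-emptiness of the fibres over the closed points of `U` from non-emptiness of the `k`-point
fibres over the `k`-points of `U`. [cite: GortzWedhorn2020, Prop. 3.35] -/
theorem nonempty_preimage_of_isClosed_of_nonempty_fibres [LocallyOfFiniteType S.hom] (ψ : X ⟶ S)
    (U : S.left.Opens)
    (hne : ∀ a : AlgPoints S k, a.pt ∈ U → {z : AlgPoints X k | map ψ z = a}.Nonempty)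
    (s : S.left) (hs : s ∈ U) (hcl : IsClosed ({s} : Set S.left)) :
    (ψ.left.base ⁻¹' {s}).Nonempty := by
  obtain ⟨a, rfl⟩ := AlgPoints.exists_pt_eq_of_isClosed_singleton (X := S) hcl
  exact nonempty_preimage_pt ψ a (hne a hs)

/-! ## §3 Alterations from finite non-empty fibres of `k`-points -/

/-- **A proper `k`-morphism `ψ : X → S` (`X` integral, `S` irreducible, both locally of finite type
over the algebraically closed field `k`) whose fibres of `k`-points over the `k`-points of a non-empty
open `U ⊆ S` are finite and non-empty is an ALTERATION** (★ `Resolution.IsAlteration ψ.left`: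
integral source, proper, dominant, finite over a non-empty open; via ★
`Morphisms.isAlteration_of_finite_nonempty_preimage_of_isClosed`, `S` being Jacobson).
[cite: DeJong1996, 2.20, p. 61] [cite: GortzWedhorn2020, Prop. 3.35] -/
theorem isAlteration_left_of_finite_nonempty_fibres [LocallyOfFiniteType X.hom]
    [LocallyOfFiniteType S.hom] [IsIntegral X.left] [IrreducibleSpace S.left] (ψ : X ⟶ S)
    [IsProper ψ.left] (U : S.left.Opens) (hU : (U : Set S.left).Nonempty)
    (hfin : ∀ a : AlgPoints S k, a.pt ∈ U → {z : AlgPoints X k | map ψ z = a}.Finite)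
    (hne : ∀ a : AlgPoints S k, a.pt ∈ U → {z : AlgPoints X k | map ψ z = a}.Nonempty) :
    Resolution.IsAlteration ψ.left := by
  haveI : JacobsonSpace S.left := LocallyOfFiniteType.jacobsonSpace S.hom
  exact Morphisms.isAlteration_of_finite_nonempty_preimage_of_isClosed ψ.left U hU
    (finite_preimage_of_isClosed_of_finite_fibres ψ U hfin)
    (nonempty_preimage_of_isClosed_of_nonempty_fibres ψ U hne)

/-- **Reduced general fibres from finite `k`-point fibres, given generic étaleness of alterations**
(the `k`-point form of ★ `Morphisms.exists_opens_finite_etale_isReduced_of_core`): under the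
hypotheses of `isAlteration_left_of_finite_nonempty_fibres` and GRANTED `hcore` (in characteristic
`0`: ★ `Resolution.IsAlteration.exists_isFinite_etale_morphismRestrict_of_charZero`), there is a
non-empty open `V ⊆ S` over which `ψ` is finite étale, with all fibres over `V` reduced.
[cite: Harris1992, Prop. 7.16 (p. 80)] [cite: DeJong1996, 2.20, p. 61] -/
theorem exists_opens_finite_etale_isReduced_of_fibres_of_core [LocallyOfFiniteType X.hom]
    [LocallyOfFiniteType S.hom] [IsIntegral X.left] [IrreducibleSpace S.left] (ψ : X ⟶ S)
    [IsProper ψ.left]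
    (hcore : Resolution.IsAlteration ψ.left →
      ∃ V : S.left.Opens, (V : Set S.left).Nonempty ∧ IsFinite (ψ.left ∣_ V) ∧ Etale (ψ.left ∣_ V))
    (U : S.left.Opens) (hU : (U : Set S.left).Nonempty)
    (hfin : ∀ a : AlgPoints S k, a.pt ∈ U → {z : AlgPoints X k | map ψ z = a}.Finite)
    (hne : ∀ a : AlgPoints S k, a.pt ∈ U → {z : AlgPoints X k | map ψ z = a}.Nonempty) :
    ∃ V : S.left.Opens, (V : Set S.left).Nonempty ∧ IsFinite (ψ.left ∣_ V) ∧ Etale (ψ.left ∣_ V) ∧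
      (∀ s : S.left, s ∈ V → IsReduced (ψ.left.fiber s : Scheme.{u})) ∧
      ∀ (Ω : Type u) [Field Ω] (sb : Spec (.of Ω) ⟶ S.left),
        sb.base (IsLocalRing.closedPoint Ω) ∈ V → IsReduced (Limits.pullback ψ.left sb : Scheme.{u}) := by
  haveI : JacobsonSpace S.left := LocallyOfFiniteType.jacobsonSpace S.hom
  exact Morphisms.exists_opens_finite_etale_isReduced_of_core ψ.left hcore U hU
    (finite_preimage_of_isClosed_of_finite_fibres ψ U hfin)
    (nonempty_preimage_of_isClosed_of_nonempty_fibres ψ U hne)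

end AlgPoints

end Literature.AlgebraicGeometry.Motives

end
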